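import Mathlib
import Literature.MathematicalPhysics.QuantumFieldTheory.Balaban1983to89.B5Blocks16

/-!
# Bałaban's linear block average `Q_k` (B5 (1.18)) COMMUTES WITH THE CURL UP TO STOKES, and Federbush's
# Abelian Stability Theorem for the TYPED operator: `‖∂₁(Q_kA)‖² ≤ ‖∂A‖²_η` with constant exactly 1

**Citation header (reproduction of PUBLISHED identities and one published inequality, for the tree's typed B5 operators;
literature seat `b2b-balaban-t4-lit2` gen 3 of the Bałaban lattice Yang–Mills cell `pub-balaban`; record
`t4/T4-LIT2-CITABLE-NE.md` v2.4 §8.8; companion of `Literature/…/Federbush1986/AbelianStability.lean` v1.2 §8).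
v1.0.1 (gen 4): docstring-only — two B5 page locators corrected after the cross-read GAPS C-pv12g13-7 («A(Γ) = Σ_{b⊂Γ} A_b» is
p. 19 after (1.8); (1.21) is p. 21); every declaration byte-identical to v1 p185634.**

* T. Bałaban, *Propagators and renormalization transformations for lattice gauge theories. I*, Commun. Math. Phys. **95**
  (1984) 17–40 [Balaban1984PropagatorsI] («B5», a manuscript of the series under audit — quoted here for DEFINITIONS only,
  all of them already typed in the tree: (1.1)/(1.2) the vector field `A_μ(x)` and the plaquette field
  `F_{μν}(x) = (∂_μA_ν)(x) − (∂_νA_μ)(x)` = `B5Action121.Fs`; (1.6) the blocks `B^k(y)` = `B5Block118.bpt`, partition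
  `B5Blocks16.bpt_bijective`; (1.18) «(Q_kA)_b = Σ_{x∈B^k(b₋)} η^{d+1} A([x, x(b)]), … If b = ⟨y, y + e_μ⟩, then x(b) = x + e_μ»
  = `B5Block118.QvOp` with `QvOp_mulVec`; p. 19, after (1.8): «where A(Γ) = Σ_{b⊂Γ} A_b for arbitrary contour Γ»
  = `B5Block118.lineSum` — the contour-sum notation (1.18) uses; (1.21) p. 21 the action ⟨∂A, ∂A⟩ = ½Σ_{x,μ,ν} η^d|F_{μν}(x)|²).
* T. Bałaban, J. Imbrie, A. Jaffe, *Renormalization of the Higgs model: minimizers, propagators and the stability of mean field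
  theory*, Commun. Math. Phys. **97** (1985) 299–329 [BalabanImbrieJaffe1985] (published, outside the series), p. 304:
  «(QA)_{b′} = L^{−(d+1)} Σ_{x∈B(b′_−)} Σ_{b∈Γ_{xx′}} A_b, (2.13)»; p. 309: «The averaging operator Q_k is the k-fold composition
  of the 1-step averaging operators Q for bond variables, Q_k = (Q)^k. It follows that Q_k is given by the formula (2.13), where
  L is replaced by L^k.» (renders `HOME/t4/b2b-balaban-t4-lit2/renders/bij1985/…-p006/p011-x2.png`, read as images).
* P. Federbush, *A phase cell approach to Yang–Mills theory. I. Modes, lattice-continuum duality*, Commun. Math. Phys. **107**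
  (1986) 319–329 [Federbush1986PhaseCellI], p. 321 'Abelian Stability Theorem' (0.12) «averaging decreases the action», p. 322
  'Plaquette Averaging – Closed Loop Averaging' (1.3)–(1.4), p. 323 (1.5)–(1.9) (renders `…/renders/fed1986/fed1986-cmp107-
  p003/p004/p005-x2.png`, read as images by this lineage; verbatim quotations in the companion module's header).
* T. Bałaban, *Averaging operations for lattice gauge theories*, Commun. Math. Phys. **98** (1985) 17–51 [Balaban1985Averaging]
  («B7», under audit), (48) p. 25 — the printed LINEARISED loop-averaging identity (cell register `t4/CITED-FACTS-T4.md` F-T4-64);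
  not used, named for orientation.

**What this file PROVES (kernel, 0 sorry; [folklore] finite algebra on the typed torus `Tor (fine n M)` of `B5Prop11Plancherel`,
every `d`, every block side `n ≥ 1`, every coarse torus `Π_μ ℤ/M_μ`).**
* §1 `plaq` — the plaquette SUM `A_μ(x) + A_ν(x+e_μ) − A_μ(x+e_ν) − A_ν(x)` (angle units) with `Fs N c A μ ν x = c · plaq`
  (`Fs_eq_mul_plaq`; B5's `F` carries the lattice factor `c = η⁻¹`).
* §2 `squareSum_eq_boundary` — DISCRETE ABELIAN STOKES on the `n × n` square of fine plaquettes based at `x` in the `(μ, ν)`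
  plane: `Σ_{s,t<n} plaq A μ ν (x + s e_μ + t e_ν) = A([x, x+e_μ^{(1)}]) + A([x+e_μ^{(1)}, x+e_μ^{(1)}+e_ν^{(1)}]) −
  A([x+e_ν^{(1)}, x+e_ν^{(1)}+e_μ^{(1)}]) − A([x, x+e_ν^{(1)}])` (four `lineSum`s of `n` bonds; two telescopings).
* §3 `plaq_QvOp` — THE COMMUTATION «plaquette of the average = average of the squares»:
  `plaq (Q_kA) μ ν y = η^{d+1} Σ_{j} squareSum A μ ν (n·y + j)` — the unit-lattice plaquette variable of `Q_kA` is `η^{d+1}`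
  times the sum over the `n^d` base points `x ∈ B^k(y)` of the loop variable `A(∂□_x)` of the translated unit square, i.e.
  `η ×` (the mean over the block of the sum of the `n²` fine plaquette variables inside) — Federbush I (1.3) for Γ = a plaquette /
  B7 (48) linearised / BIJ85 (2.13), for the TYPED `QvOp` (uses `QvOp_mulVec`, `bpt_add_tstep`: «B^k(y) + e_μ = B^k(y + e_μ)»).
* §4 `sum_normSq_plaq_QvOp_le` — FEDERBUSH'S ABELIAN STABILITY THEOREM FOR THE TYPED OPERATOR, B5 normalisation:
  `n^d · Σ_y ‖plaq (Q_kA) μ ν y‖² ≤ n² · Σ_x ‖plaq A μ ν x‖²` for every complex vector field `A` on `T_η`, every plane; in B5's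
  weighted norms (`Fs` with `c = 1` on `T₁^{(k)}`, `c = n = η⁻¹` on `T_η`, and the `η^d` site weight) this is
  `sum_normSq_Fs_QvOp_le`: `Σ_y ‖F^{(1)}_{μν}(Q_kA)(y)‖² ≤ η^d Σ_x ‖F^{(η)}_{μν}(A)(x)‖²`, i.e. **`‖∂₁(Q_kA)‖² ≤ ‖∂A‖²_η` with
  constant exactly 1** — by Jensen/Cauchy–Schwarz on the `n^{d+2}`-term sum of §3, the block partition `bpt_bijective`
  and translation invariance of `Σ_x`.

**Why (the cell's use; record §8.8, GAPS A-t4lit2g3-1).**  With B5 p. 29 «H_kB is a minimum of ½⟨∂A,∂A⟩ on the hyperplane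
{A : Q_kA = B, R∂*A = 0}» and (1.65) «⟨B, Δ_kB⟩ = ⟨∂H_kB, ∂H_kB⟩» (a DEFINITION; resp. BIJ85 (4.3.1)–(4.3.2), (4.1.5)), §4 applied
to `A = H_kB` READS `⟨B, Δ_kB⟩ ≥ ‖∂₁B‖²`: the LOWER bound of B5 (1.67) with the sharp constant `γ₀ = 1`, and the curl half of
BIJ85 (4.2.3)/Thm 7.1.1 «bounded below by ε‖∂B‖² (see also [6I, 8])» with `ε = 1`, [8] = Federbush I — Fourier-free, for the
variational abelian `Δ_k`.  That reading needs only `Q_k(H_kB) = B`, which this file does not supply (no `H_k` is typed here):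
the theorem is stated for EVERY `A`, and `sum_normSq_plaq_le_of_QvOp_eq` packages the fibre form `Q_kA = B ⇒ ‖∂₁B‖² ≤ ‖∂A‖²_η`.

HONEST SCOPE.  Finite algebra about the typed linear average of B5 (1.18) on complex vector fields; abelian (the `U = 1` /
𝔤-valued linearisation layer of the cell's NE2⁰); NOT an η-rate (the cell's NE2 stays NEW), nothing about non-abelian
averages (B7 (15)) or minimisers, no statement of B5/B7/BIJ85 is used as a hypothesis.  NOT summit progress (rung (B)+1 ≠
infinite volume ≠ mass gap ≠ Clay).
-/

open scoped BigOperators Matrix ComplexConjugate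
open Finset Complex

namespace Literature.MathematicalPhysics.QuantumFieldTheory.Balaban1983to89.B5AverageCurlStokes

open Literature.MathematicalPhysics.QuantumFieldTheory.Balaban1983to89.B5Prop11Plancherel
open Literature.MathematicalPhysics.QuantumFieldTheory.Balaban1983to89.B5Action121
open Literature.MathematicalPhysics.QuantumFieldTheory.Balaban1983to89.B5Block118
open Literature.MathematicalPhysics.QuantumFieldTheory.Balaban1983to89.B5Blocks16

noncomputable section

/-! ## §1 The plaquette sum in angle units -/

section Plaquette

variable {d : ℕ} (N : Fin d → ℕ) [hN : ∀ μ, NeZero (N μ)]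

/-- The plaquette SUM of a vector field around `p = ⟨x, x+e_μ, x+e_μ+e_ν, x+e_ν⟩` (angle units, no lattice factor):
`A_μ(x) + A_ν(x + e_μ) − A_μ(x + e_ν) − A_ν(x)` — B5 (1.2) without the `ε⁻¹`.
[cite: Balaban1984PropagatorsI, (1.2) p.18] -/
def plaq (A : Tor N × Fin d → ℂ) (μ ν : Fin d) (x : Tor N) : ℂ :=
  A (x, μ) + A (x + unitVec N μ, ν) - A (x + unitVec N ν, μ) - A (x, ν)

/-- B5's plaquette field (1.2) is the lattice factor times the plaquette sum: `F_{μν} = c · plaq` (`c = η⁻¹`).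
[cite: Balaban1984PropagatorsI, (1.2) p.18] -/
theorem Fs_eq_mul_plaq (c : ℂ) (A : Tor N × Fin d → ℂ) (μ ν : Fin d) (x : Tor N) :
    Fs N c A μ ν x = c * plaq N A μ ν x := by
  rw [Fs_apply, plaq]

omit hN in
/-- Unfolding lemma for `plaq`. [folklore] -/
theorem plaq_apply (A : Tor N × Fin d → ℂ) (μ ν : Fin d) (x : Tor N) :
    plaq N A μ ν x = A (x, μ) + A (x + unitVec N μ, ν) - A (x + unitVec N ν, μ) - A (x, ν) := rfl

end Plaquette

/-! ## §2 Discrete abelian Stokes on the `n × n` square -/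

section Stokes

variable {d : ℕ} (n : ℕ) [NeZero n] (M : Fin d → ℕ) [hM : ∀ μ, NeZero (M μ)]

omit [NeZero n] in
/-- Downward telescoping along a line of `n` bonds (companion of `B5Block118.sum_fin_telescope`). [folklore] -/
theorem tel_down (g : ℕ → ℂ) (n : ℕ) : ∑ t : Fin n, (g t - g ((t : ℕ) + 1)) = g 0 - g n := by
  have h := sum_fin_telescope g n
  have h' : ∑ t : Fin n, (g t - g ((t : ℕ) + 1)) = -∑ t : Fin n, (g ((t : ℕ) + 1) - g t) := by
    rw [← Finset.sum_neg_distrib]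
    exact Finset.sum_congr rfl fun t _ => by ring
  rw [h', h]
  ring

/-- The sum of the `n²` fine plaquette variables of the square of side `n` (one coarse unit) based at `x` in the `(μ, ν)`
plane: `Σ_{s,t<n} plaq A μ ν (x + s e_μ + t e_ν)`. [folklore] -/
def squareSum (A : Tor (fine n M) × Fin d → ℂ) (μ ν : Fin d) (x : Tor (fine n M)) : ℂ :=
  ∑ s : Fin n, ∑ t : Fin n, plaq (fine n M) A μ ν (x + tstep (fine n M) μ s + tstep (fine n M) ν t)

omit [NeZero n] hM in
/-- DISCRETE ABELIAN STOKES: the sum of the fine plaquette variables over the `n × n` square equals the loop variable of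
its boundary, written with B5's straight-contour sums `lineSum` (B5 p. 19 after (1.8) «A(Γ) = Σ_{b⊂Γ} A_b», the notation of (1.18)):
`Σ_{s,t} plaq = A([x, x+ne_μ]) + A([x+ne_μ, x+ne_μ+ne_ν]) − A([x+ne_ν, x+ne_ν+ne_μ]) − A([x, x+ne_ν])`.
Two telescopings (`B5Block118.sum_fin_telescope`).  Federbush I p. 322 obtains (1.4) from (1.3) by exactly this step
(«The particular case that Γ is a plaquette is of greatest interest»). [folklore] -/
theorem squareSum_eq_boundary (A : Tor (fine n M) × Fin d → ℂ) (μ ν : Fin d) (x : Tor (fine n M)) :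
    squareSum n M A μ ν x
      = lineSum n M A x μ + lineSum n M A (x + tstep (fine n M) μ n) ν
        - lineSum n M A (x + tstep (fine n M) ν n) μ - lineSum n M A x ν := by
  -- split each plaquette variable into its μ-part (telescoping in t) and its ν-part (telescoping in s)
  have hsplit : squareSum n M A μ ν x
      = (∑ s : Fin n, ∑ t : Fin n,
          (A (x + tstep (fine n M) μ s + tstep (fine n M) ν t, μ)
            - A (x + tstep (fine n M) μ s + tstep (fine n M) ν ((t : ℕ) + 1), μ)))
        + ∑ s : Fin n, ∑ t : Fin n,
          (A (x + tstep (fine n M) μ ((s : ℕ) + 1) + tstep (fine n M) ν t, ν)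
            - A (x + tstep (fine n M) μ s + tstep (fine n M) ν t, ν)) := by
    rw [squareSum, ← Finset.sum_add_distrib]
    refine Finset.sum_congr rfl fun s _ => ?_
    rw [← Finset.sum_add_distrib]
    refine Finset.sum_congr rfl fun t _ => ?_
    rw [plaq_apply, tstep_succ, tstep_succ]
    have e1 : x + tstep (fine n M) μ s + tstep (fine n M) ν t + unitVec (fine n M) μ
        = x + (tstep (fine n M) μ s + unitVec (fine n M) μ) + tstep (fine n M) ν t := by abel
    have e2 : x + tstep (fine n M) μ s + tstep (fine n M) ν t + unitVec (fine n M) ν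
        = x + tstep (fine n M) μ s + (tstep (fine n M) ν t + unitVec (fine n M) ν) := by abel
    rw [e1, e2]
    ring
  -- telescoping in t for fixed s
  have hμ : ∀ s : Fin n, ∑ t : Fin n,
      (A (x + tstep (fine n M) μ s + tstep (fine n M) ν t, μ)
        - A (x + tstep (fine n M) μ s + tstep (fine n M) ν ((t : ℕ) + 1), μ))
      = A (x + tstep (fine n M) μ s, μ) - A (x + tstep (fine n M) ν n + tstep (fine n M) μ s, μ) := by
    intro s
    have h := tel_down (fun t => A (x + tstep (fine n M) μ s + tstep (fine n M) ν t, μ)) n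
    rw [tstep_zero, add_zero, add_right_comm x (tstep (fine n M) μ s) (tstep (fine n M) ν n)] at h
    exact h
  -- telescoping in s for fixed t
  have hν : ∀ t : Fin n, ∑ s : Fin n,
      (A (x + tstep (fine n M) μ ((s : ℕ) + 1) + tstep (fine n M) ν t, ν)
        - A (x + tstep (fine n M) μ s + tstep (fine n M) ν t, ν))
      = A (x + tstep (fine n M) μ n + tstep (fine n M) ν t, ν) - A (x + tstep (fine n M) ν t, ν) := by
    intro t
    have h := sum_fin_telescope (fun s => A (x + tstep (fine n M) μ s + tstep (fine n M) ν t, ν)) n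
    rw [tstep_zero, add_zero] at h
    exact h
  rw [hsplit]
  simp_rw [hμ]
  rw [Finset.sum_comm]
  simp_rw [hν]
  rw [Finset.sum_sub_distrib, Finset.sum_sub_distrib]
  simp only [lineSum]
  ring

end Stokes

/-! ## §3 The plaquette of the block average = `η^{d+1}` × the sum of the squares over the block -/

section Commutation

variable {d : ℕ} (n : ℕ) [NeZero n] (M : Fin d → ℕ) [hM : ∀ μ, NeZero (M μ)]

/-- «PLAQUETTE AVERAGING – CLOSED LOOP AVERAGING» FOR THE TYPED `Q_k` OF B5 (1.18): the unit-lattice plaquette variable of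
the averaged field is `η^{d+1} Σ_{x ∈ B^k(y)} A(∂□_x)`, the boundary loop variables of the translated unit squares being
written, by §2, as the sums of the `n²` fine plaquette variables inside:
`plaq (Q_kA) μ ν y = (1/n)^{d+1} · Σ_j squareSum A μ ν (n·y + j)`.  Ingredients: `QvOp_mulVec` ((1.18)),
`bpt_add_tstep` («x(b) is a point in B^k(b₊) obtained from x by translation by b»), `squareSum_eq_boundary`.
[cite: Federbush1986PhaseCellI, (1.3)–(1.4) p. 322; BalabanImbrieJaffe1985, (2.13) p. 304; Balaban1984PropagatorsI, (1.18) p. 20] -/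
theorem plaq_QvOp (A : Tor (fine n M) × Fin d → ℂ) (μ ν : Fin d) (y : Tor M) :
    plaq M (QvOp n M *ᵥ A) μ ν y
      = 1 / (n : ℂ) ^ (d + 1) * ∑ j : Fin d → Fin n, squareSum n M A μ ν (bpt n M y j) := by
  rw [plaq_apply, QvOp_mulVec, QvOp_mulVec, QvOp_mulVec, QvOp_mulVec]
  simp_rw [squareSum_eq_boundary, ← bpt_add_tstep]
  rw [← mul_add, ← mul_sub, ← mul_sub, ← Finset.sum_add_distrib, ← Finset.sum_sub_distrib,
    ← Finset.sum_sub_distrib]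

/-- Fibre form of §3: on the fibre `{A : Q_kA = B}` the coarse plaquette variables of `B` are determined by the fine ones of
`A`. [folklore] -/
theorem plaq_eq_of_QvOp_eq (A : Tor (fine n M) × Fin d → ℂ) (B : Tor M × Fin d → ℂ) (hB : QvOp n M *ᵥ A = B)
    (μ ν : Fin d) (y : Tor M) :
    plaq M B μ ν y = 1 / (n : ℂ) ^ (d + 1) * ∑ j : Fin d → Fin n, squareSum n M A μ ν (bpt n M y j) := by
  rw [← hB, plaq_QvOp]

end Commutation

/-! ## §4 Federbush's Abelian Stability Theorem for the typed `Q_k`, B5 normalisation -/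

section Stability

variable {d : ℕ} (n : ℕ) [NeZero n] (M : Fin d → ℕ) [hM : ∀ μ, NeZero (M μ)]

/-- Translation invariance of a full torus sum. [folklore] -/
theorem sum_translate (g : Tor (fine n M) → ℝ) (v : Tor (fine n M)) :
    ∑ x, g (x + v) = ∑ x, g x :=
  Equiv.sum_comp (Equiv.addRight v) g

/-- Block decomposition of a real-valued torus sum: `Σ_x g(x) = Σ_y Σ_j g(n·y + j)` (B5 (1.6), `B5Blocks16.bpt_bijective`).
[cite: Balaban1984PropagatorsI, (1.6) p.18] -/
theorem sum_blocks_real (g : Tor (fine n M) → ℝ) :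
    ∑ x, g x = ∑ y : Tor M, ∑ j : Fin d → Fin n, g (bpt n M y j) := by
  rw [← (bpt_bijective n M).sum_comp g, Fintype.sum_prod_type]

/-- Swapping an outer pair of summations with an inner pair (via product types). [folklore] -/
theorem sum_comm_22 {α β γ δ : Type*} [Fintype α] [Fintype β] [Fintype γ] [Fintype δ]
    (G : α → β → γ → δ → ℝ) :
    (∑ a, ∑ b, ∑ c, ∑ e, G a b c e) = ∑ c, ∑ e, ∑ a, ∑ b, G a b c e := by
  have l1 : (∑ a, ∑ b, ∑ c, ∑ e, G a b c e) = ∑ p : α × β, ∑ q : γ × δ, G p.1 p.2 q.1 q.2 := by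
    simp only [Fintype.sum_prod_type]
  have r1 : (∑ c, ∑ e, ∑ a, ∑ b, G a b c e) = ∑ q : γ × δ, ∑ p : α × β, G p.1 p.2 q.1 q.2 := by
    simp only [Fintype.sum_prod_type]
  rw [l1, r1, Finset.sum_comm]

omit [NeZero n] in
/-- Jensen / Cauchy–Schwarz for the block-and-square sum: `‖Σ_j Σ_s Σ_t z‖² ≤ n^d·n·n · Σ_j Σ_s Σ_t ‖z‖²`. [folklore] -/
theorem normSq_tripleSum_le (z : (Fin d → Fin n) → Fin n → Fin n → ℂ) :
    ‖∑ j : Fin d → Fin n, ∑ s : Fin n, ∑ t : Fin n, z j s t‖ ^ 2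
      ≤ (n : ℝ) ^ (d + 2) * ∑ j : Fin d → Fin n, ∑ s : Fin n, ∑ t : Fin n, ‖z j s t‖ ^ 2 := by
  -- flatten to one Finset sum over the product type
  have hflat : ∑ j : Fin d → Fin n, ∑ s : Fin n, ∑ t : Fin n, z j s t
      = ∑ p : (Fin d → Fin n) × Fin n × Fin n, z p.1 p.2.1 p.2.2 := by
    rw [Fintype.sum_prod_type]
    refine Finset.sum_congr rfl fun j _ => ?_
    rw [Fintype.sum_prod_type]
  have hflat' : ∑ j : Fin d → Fin n, ∑ s : Fin n, ∑ t : Fin n, ‖z j s t‖ ^ 2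
      = ∑ p : (Fin d → Fin n) × Fin n × Fin n, ‖z p.1 p.2.1 p.2.2‖ ^ 2 := by
    rw [Fintype.sum_prod_type]
    refine Finset.sum_congr rfl fun j _ => ?_
    rw [Fintype.sum_prod_type]
  rw [hflat, hflat']
  have hcard : (Finset.univ : Finset ((Fin d → Fin n) × Fin n × Fin n)).card = n ^ (d + 2) := by
    rw [Finset.card_univ, Fintype.card_prod, Fintype.card_prod, Fintype.card_fun, Fintype.card_fin, Fintype.card_fin]
    ring
  calc ‖∑ p : (Fin d → Fin n) × Fin n × Fin n, z p.1 p.2.1 p.2.2‖ ^ 2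
      ≤ (∑ p : (Fin d → Fin n) × Fin n × Fin n, ‖z p.1 p.2.1 p.2.2‖) ^ 2 := by
        gcongr
        exact norm_sum_le _ _
    _ ≤ (Finset.univ : Finset ((Fin d → Fin n) × Fin n × Fin n)).card
          * ∑ p : (Fin d → Fin n) × Fin n × Fin n, ‖z p.1 p.2.1 p.2.2‖ ^ 2 :=
        sq_sum_le_card_mul_sum_sq
    _ = (n : ℝ) ^ (d + 2) * ∑ p : (Fin d → Fin n) × Fin n × Fin n, ‖z p.1 p.2.1 p.2.2‖ ^ 2 := by
        rw [hcard]; push_cast; ring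

/-- FEDERBUSH'S ABELIAN STABILITY THEOREM FOR BAŁABAN'S TYPED LINEAR AVERAGE `Q_k` (B5 (1.18)), angle units, per coordinate
plane, every `d`, every block side `n ≥ 1`, every torus, every COMPLEX vector field:
`n^d · Σ_y ‖plaq (Q_kA) μ ν y‖² ≤ n² · Σ_x ‖plaq A μ ν x‖²`, i.e. `Σ_y |coarse plaquette sum|² ≤ η^{d−2} Σ_x |fine plaquette
sum|²` — «averaging decreases the action» (B5's weighted form is the next theorem).  Proof: §3, Jensen on the `n^{d+2}` terms,
the block partition and translation invariance (each fine plaquette is met by exactly `n²` (base point, offset) pairs, so the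
row sums are `n²·η^{d+1}·… ` — Federbush's (1.5)/(1.6) need not be named: the counting is done directly).
[cite: Federbush1986PhaseCellI, 'Abelian Stability Theorem' (0.12) p. 321, (1.3)–(1.9) pp. 322–323;
BalabanImbrieJaffe1985, (2.13) p. 304, p. 309] -/
theorem sum_normSq_plaq_QvOp_le (A : Tor (fine n M) × Fin d → ℂ) (μ ν : Fin d) :
    (n : ℝ) ^ d * ∑ y : Tor M, ‖plaq M (QvOp n M *ᵥ A) μ ν y‖ ^ 2
      ≤ (n : ℝ) ^ 2 * ∑ x : Tor (fine n M), ‖plaq (fine n M) A μ ν x‖ ^ 2 := by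
  have hn : (0 : ℝ) < n := by exact_mod_cast Nat.pos_of_ne_zero (NeZero.ne n)
  have hnne : (n : ℝ) ≠ 0 := hn.ne'
  -- pointwise bound from §3 + Jensen
  have hpt : ∀ y : Tor M, ‖plaq M (QvOp n M *ᵥ A) μ ν y‖ ^ 2
      ≤ (1 / (n : ℝ) ^ (d + 1)) ^ 2 * ((n : ℝ) ^ (d + 2)
          * ∑ j : Fin d → Fin n, ∑ s : Fin n, ∑ t : Fin n,
              ‖plaq (fine n M) A μ ν (bpt n M y j + tstep (fine n M) μ s + tstep (fine n M) ν t)‖ ^ 2) := by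
    intro y
    rw [plaq_QvOp, norm_mul, mul_pow]
    have hc : ‖(1 : ℂ) / (n : ℂ) ^ (d + 1)‖ = 1 / (n : ℝ) ^ (d + 1) := by
      rw [norm_div, norm_one, norm_pow, Complex.norm_natCast]
    rw [hc]
    refine mul_le_mul_of_nonneg_left ?_ (by positivity)
    simp only [squareSum]
    exact normSq_tripleSum_le n (fun j s t =>
      plaq (fine n M) A μ ν (bpt n M y j + tstep (fine n M) μ s + tstep (fine n M) ν t))
  -- sum over y and reorganise: Σ_y Σ_j Σ_s Σ_t g(bpt y j + v_{st}) = Σ_s Σ_t Σ_x g(x + v_{st}) = n² Σ_x g x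
  have hsum : ∑ y : Tor M, ∑ j : Fin d → Fin n, ∑ s : Fin n, ∑ t : Fin n,
        ‖plaq (fine n M) A μ ν (bpt n M y j + tstep (fine n M) μ s + tstep (fine n M) ν t)‖ ^ 2
      = (n : ℝ) ^ 2 * ∑ x : Tor (fine n M), ‖plaq (fine n M) A μ ν x‖ ^ 2 := by
    have step1 : (∑ y : Tor M, ∑ j : Fin d → Fin n, ∑ s : Fin n, ∑ t : Fin n,
          ‖plaq (fine n M) A μ ν (bpt n M y j + tstep (fine n M) μ s + tstep (fine n M) ν t)‖ ^ 2)
        = ∑ s : Fin n, ∑ t : Fin n, ∑ y : Tor M, ∑ j : Fin d → Fin n,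
          ‖plaq (fine n M) A μ ν (bpt n M y j + tstep (fine n M) μ s + tstep (fine n M) ν t)‖ ^ 2 :=
      sum_comm_22 (fun (y : Tor M) (j : Fin d → Fin n) (s : Fin n) (t : Fin n) =>
        ‖plaq (fine n M) A μ ν (bpt n M y j + tstep (fine n M) μ s + tstep (fine n M) ν t)‖ ^ 2)
    rw [step1]
    have step2 : ∀ s t : Fin n, ∑ y : Tor M, ∑ j : Fin d → Fin n,
          ‖plaq (fine n M) A μ ν (bpt n M y j + tstep (fine n M) μ s + tstep (fine n M) ν t)‖ ^ 2
        = ∑ x : Tor (fine n M), ‖plaq (fine n M) A μ ν x‖ ^ 2 := by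
      intro s t
      rw [← sum_blocks_real n M (fun x => ‖plaq (fine n M) A μ ν (x + tstep (fine n M) μ s + tstep (fine n M) ν t)‖ ^ 2)]
      simp_rw [add_assoc]
      exact sum_translate n M (fun x => ‖plaq (fine n M) A μ ν x‖ ^ 2) _
    simp_rw [step2]
    simp only [Finset.sum_const, Finset.card_univ, Fintype.card_fin, nsmul_eq_mul]
    ring
  calc (n : ℝ) ^ d * ∑ y : Tor M, ‖plaq M (QvOp n M *ᵥ A) μ ν y‖ ^ 2
      ≤ (n : ℝ) ^ d * ∑ y : Tor M, (1 / (n : ℝ) ^ (d + 1)) ^ 2 * ((n : ℝ) ^ (d + 2)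
          * ∑ j : Fin d → Fin n, ∑ s : Fin n, ∑ t : Fin n,
              ‖plaq (fine n M) A μ ν (bpt n M y j + tstep (fine n M) μ s + tstep (fine n M) ν t)‖ ^ 2) := by
        gcongr with y
        exact hpt y
    _ = (n : ℝ) ^ d * ((1 / (n : ℝ) ^ (d + 1)) ^ 2 * (n : ℝ) ^ (d + 2))
          * ∑ y : Tor M, ∑ j : Fin d → Fin n, ∑ s : Fin n, ∑ t : Fin n,
              ‖plaq (fine n M) A μ ν (bpt n M y j + tstep (fine n M) μ s + tstep (fine n M) ν t)‖ ^ 2 := by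
        rw [Finset.mul_sum, Finset.mul_sum]
        refine Finset.sum_congr rfl fun y _ => ?_
        ring
    _ = (n : ℝ) ^ d * ((1 / (n : ℝ) ^ (d + 1)) ^ 2 * (n : ℝ) ^ (d + 2))
          * ((n : ℝ) ^ 2 * ∑ x : Tor (fine n M), ‖plaq (fine n M) A μ ν x‖ ^ 2) := by rw [hsum]
    _ = (n : ℝ) ^ 2 * ∑ x : Tor (fine n M), ‖plaq (fine n M) A μ ν x‖ ^ 2 := by
        field_simp
        ring

/-- THE SAME IN B5'S NORMALISATION — `‖∂₁(Q_kA)‖² ≤ ‖∂A‖²_η` with constant exactly `1`, per coordinate plane: with the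
plaquette fields `F = Fs` of (1.2) carrying the lattice factor (`c = 1` on the unit lattice `T₁^{(k)}`, `c = n = η⁻¹` on `T_η`)
and the `η^d` site weight of B5's scalar product on `T_η`,
`Σ_y ‖F^{(1)}_{μν}(Q_kA)(y)‖² ≤ η^d · Σ_x ‖F^{(η)}_{μν}(A)(x)‖²`.  Summed over `μ < ν` this is ⟨∂₁Q_kA, ∂₁Q_kA⟩ ≤ ⟨∂A, ∂A⟩_η
((1.21)); applied to `A = H_kB` (B5 p. 29: «H_kB is a minimum of ½⟨∂A,∂A⟩ on the hyperplane {A : Q_kA = B, …}», (1.65)) it READS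
`⟨B, Δ_kB⟩ ≥ ‖∂₁B‖²` — the lower bound of (1.67) with `γ₀ = 1` (sharp), BIJ85 Thm 7.1.1's curl half with `ε = 1` via [8].
[cite: Federbush1986PhaseCellI, 'Abelian Stability Theorem' (0.12) p. 321; Balaban1984PropagatorsI, (1.18) p. 20, (1.21) p. 21;
BalabanImbrieJaffe1985, (4.3.1)–(4.3.2) p. 311, p. 325 «(see also [6I, 8])»] -/
theorem sum_normSq_Fs_QvOp_le (A : Tor (fine n M) × Fin d → ℂ) (μ ν : Fin d) :
    ∑ y : Tor M, ‖Fs M 1 (QvOp n M *ᵥ A) μ ν y‖ ^ 2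
      ≤ (1 / (n : ℝ) ^ d) * ∑ x : Tor (fine n M), ‖Fs (fine n M) (n : ℂ) A μ ν x‖ ^ 2 := by
  have hn : (0 : ℝ) < n := by exact_mod_cast Nat.pos_of_ne_zero (NeZero.ne n)
  have h := sum_normSq_plaq_QvOp_le n M A μ ν
  simp_rw [Fs_eq_mul_plaq, one_mul, norm_mul, Complex.norm_natCast, mul_pow]
  rw [← Finset.mul_sum, ← mul_assoc]
  rw [show 1 / (n : ℝ) ^ d * (n : ℝ) ^ 2 = (n : ℝ) ^ 2 / (n : ℝ) ^ d by ring, div_mul_eq_mul_div,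
    le_div_iff₀ (by positivity), mul_comm]
  exact h

/-- FIBRE FORM: on the fibre `{A : Q_kA = B}` of a unit-lattice field `B`, `‖∂₁B‖² ≤ ‖∂A‖²_η` (per plane, B5 normalisation) —
the inequality that, with `A = H_kB` on the hyperplane `Q_kA = B`, is «γ₀⟨∂₁B, ∂₁B⟩ ≤ ⟨B, Δ_kB⟩» with `γ₀ = 1` for the
variational abelian `Δ_k` of (1.65).
[cite: Federbush1986PhaseCellI, (0.12) p. 321; BalabanImbrieJaffe1985, (4.1.5) p. 310, (4.3.1)–(4.3.2) p. 311] -/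
theorem sum_normSq_Fs_le_of_QvOp_eq (A : Tor (fine n M) × Fin d → ℂ) (B : Tor M × Fin d → ℂ)
    (hB : QvOp n M *ᵥ A = B) (μ ν : Fin d) :
    ∑ y : Tor M, ‖Fs M 1 B μ ν y‖ ^ 2
      ≤ (1 / (n : ℝ) ^ d) * ∑ x : Tor (fine n M), ‖Fs (fine n M) (n : ℂ) A μ ν x‖ ^ 2 := by
  rw [← hB]
  exact sum_normSq_Fs_QvOp_le n M A μ ν

end Stability

end

end Literature.MathematicalPhysics.QuantumFieldTheory.Balaban1983to89.B5AverageCurlStokes
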